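import Literature.NumberTheory.Transcendental.NesterenkoEliminationZeros
import Literature.NumberTheory.Transcendental.NesterenkoEliminationPrimeForm
import HarnessLib

/-!
# Zeros of the section form of a projective curve (crux `ApproximationProperty`, stub `curveHilbert_sectionFormZeros`)

Crux `stmt-Schanuel-6117` (`Summit.Schanuel.Schanuel.Theses.DiophantineDichotomy.ApproximationProperty`),
line `orbit-interpolation-determinant`. This file proves the registered stub
`curveHilbert_sectionFormZeros` (a helper of the `t = 3` descent `CycleAPIAt3`, Hilbert-function lower
bound for a prime space curve via rational hyperplane sections). Everything here is PROVED; no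
definitions, no named facts.

Let `𝔭 ⊂ ℚ[x₀, …, x_m]` (`Rx m`) be a homogeneous prime ideal with `dim ℚ[x̲] ⧸ 𝔭 = 2` (a projective
curve) and let `F = chowForm 𝔭 2 ∈ ℚ[u₁, u₂]` be its associated (Chow) form (Nesterenko–Philippon, LNM
1752, Ch. 3 §4, Def. 4.3, Prop. 4.4). For a rational vector `v` the SECTION FORM `F(v; x̲) ∈ ℂ[x̲]` is
`F` with the first group of hyperplane variables specialised to `v` and the second group renamed to `x̲`
(realised as `MvPolynomial.aeval θ F` for a substitution `θ` with `θ(u_{1k}) = v_k`, `θ(u_{2k}) = x_k`).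
The dictionary proved here (`CurveHilbertSectionForm.eval_aeval_chowForm_eq_zero_iff`, registered stub
`curveHilbert_sectionFormZeros`): **`F(v; u) = 0` iff some projective zero `β ∈ V(𝔭)` lies on both
hyperplanes `v · β = 0` and `β · u = 0`.** It is the specialisation at the point `(v, u)` of the tree's
zeros theorem `Nesterenko.aeval_chowForm_eq_zero_iff` ("the associated form vanishes at `(u₁, …, u_r)`
iff the hyperplanes `uᵢ · x̲ = 0` have a common point on `V(I)`", for `Ī(r)` principal), the
principality of `p̄(2)` for a homogeneous prime of Krull dimension `2` being the tree's
`Nesterenko.isPrincipal_elimIdeal_of_isPrime` (LNM 1752 Ch. 3 Prop. 4.4, prime case); the only new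
ingredient is the evaluation identity `(aeval θ F)(u) = F(s ↦ θ_s(u))`
(`CurveHilbertSectionForm.eval_aeval`).

Sources: Yu. V. Nesterenko, P. Philippon (eds.), *Introduction to Algebraic Independence Theory*,
LNM 1752, Springer 2001, Ch. 3 §4, Def. 4.3, Prop. 4.4 (p. 38); I. R. Shafarevich, *Basic Algebraic
Geometry 1*, I.5.2 (main theorem of elimination theory); M. Chardin, Bull. SMF 117 (1989) (sections of
curves and Hilbert functions).
-/

set_option linter.dupNamespace false

noncomputable section

namespace Summit.Schanuel.Schanuel.Cruxes.ApproximationProperty.OrbitInterpolationDeterminant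

open Literature.NumberTheory.Transcendental Literature.NumberTheory.Transcendental.Nesterenko MvPolynomial
open scoped BigOperators

namespace CurveHilbertSectionForm

variable {m : ℕ}

/-- **Evaluating a specialisation.** Substituting polynomials `θ_s ∈ ℂ[x̲]` for the variables of
`F ∈ ℚ[U]` and then evaluating at `x̲ = u` is evaluating `F` at the complex point `s ↦ θ_s(u)`:
`(aeval θ F)(u) = F(θ(u))`. [folklore] -/
theorem eval_aeval {σ τ : Type*} (θ : σ → MvPolynomial τ ℂ) (u : τ → ℂ) (F : MvPolynomial σ ℚ) :
    eval u (aeval θ F) = aeval (fun s => eval u (θ s)) F := by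
  have h : (eval u).comp (algebraMap ℚ (MvPolynomial τ ℂ)) = algebraMap ℚ ℂ := Subsingleton.elim _ _
  rw [map_aeval, h, ← aeval_eq_eval₂Hom]

/-- **Zeros of the section form of a projective curve.** For a homogeneous prime
`𝔭 ⊂ ℚ[x₀, …, x_m]` with `dim ℚ[x̲] ⧸ 𝔭 = 2`, a rational vector `v` and a substitution `θ` of the
hyperplane variables with `θ(u_{2k}) = x_k`, `θ(u_{1k}) = v_k`, the section form
`F(v; x̲) = (chowForm 𝔭 2)(θ)` vanishes at `u ∈ ℂ^{m+1}` iff some `β ∈ V(𝔭)` satisfies `v · β = 0` and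
`β · u = 0` (the zeros theorem for the associated form, `Ī(2) = (F)` being principal for a prime of
dimension `2`, specialised at the point `(v, u)`). [cite: NesterenkoPhilippon2001, Ch. 3 Prop. 4.4 (p. 38)] -/
theorem eval_aeval_chowForm_eq_zero_iff {𝔭 : Ideal (Rx m)} (h𝔭 : 𝔭.IsPrime)
    (hhom : letI := MvPolynomial.gradedAlgebra (σ := Fin (m + 1)) (R := ℚ)
      𝔭.IsHomogeneous (homogeneousSubmodule (Fin (m + 1)) ℚ))
    (hdim : ringKrullDim (Rx m ⧸ 𝔭) = (1 + 1 : ℕ)) (v : Fin (m + 1) → ℚ)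
    {θ : Fin (1 + 1) × Fin (m + 1) → MvPolynomial (Fin (m + 1)) ℂ}
    (hθ1 : ∀ k, θ (Fin.last 1, k) = X k) (hθ0 : ∀ k, θ (0, k) = C ((v k : ℚ) : ℂ))
    (u : Fin (m + 1) → ℂ) :
    eval u (aeval θ (chowForm 𝔭 (1 + 1))) = 0 ↔
      ∃ β ∈ projZeros 𝔭, (∑ k, ((v k : ℚ) : ℂ) * β k = 0) ∧ ∑ k, β k * u k = 0 := by
  have hpr : (elimIdeal 𝔭 (1 + 1)).IsPrincipal :=
    isPrincipal_elimIdeal_of_isPrime h𝔭 hhom (by norm_num) hdim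
  rw [eval_aeval, aeval_chowForm_eq_zero_iff hhom hpr]
  refine exists_congr fun β => and_congr_right fun _ => ?_
  -- the two hyperplane conditions, `i = 0` (coefficients `v`) and `i = last` (coefficients `u`)
  have s0 : ∑ j, eval u (θ (0, j)) * β j = ∑ k, ((v k : ℚ) : ℂ) * β k :=
    Finset.sum_congr rfl fun k _ => by rw [hθ0, eval_C]
  have s1 : ∑ j, eval u (θ (Fin.last 1, j)) * β j = ∑ k, β k * u k :=
    Finset.sum_congr rfl fun k _ => by rw [hθ1, eval_X, mul_comm]
  constructor
  · intro h
    exact ⟨s0.symm.trans (h 0), s1.symm.trans (h (Fin.last 1))⟩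
  · rintro ⟨h0, h1⟩ i
    induction i using Fin.lastCases with
    | last => exact s1.trans h1
    | cast j =>
      obtain rfl : j = 0 := Subsingleton.elim _ _
      exact s0.trans h0

end CurveHilbertSectionForm

/-- **Zeros of the section form of a projective curve (registered helper
`curveHilbert_sectionFormZeros`).** For a homogeneous prime `𝔭 ⊂ ℚ[x₀, …, x_m]` of Krull dimension `2`,
a rational vector `v` and a substitution `θ` of the hyperplane variables of the associated form
`F = chowForm 𝔭 2` with `θ(u_{2k}) = x_k` and `θ(u_{1k}) = v_k`, the section form `F(v; x̲) = F(θ)`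
vanishes at `u` iff some projective zero `β` of `𝔭` lies on both hyperplanes `v · β = 0` and
`β · u = 0`. [cite: NesterenkoPhilippon2001, Ch. 3 Prop. 4.4 (p. 38)] -/
theorem curveHilbert_sectionFormZeros : ∀ (m : ℕ) (𝔭 : Ideal (Rx m)), 𝔭.IsPrime → (letI := MvPolynomial.gradedAlgebra (σ := Fin (m + 1)) (R := ℚ); 𝔭.IsHomogeneous (MvPolynomial.homogeneousSubmodule (Fin (m + 1)) ℚ)) → ringKrullDim (Rx m ⧸ 𝔭) = (1 + 1 : ℕ) → ∀ (v : Fin (m + 1) → ℚ) (θ : Fin (1 + 1) × Fin (m + 1) → MvPolynomial (Fin (m + 1)) ℂ), (∀ k, θ (Fin.last 1, k) = MvPolynomial.X k) → (∀ k, θ (0, k) = MvPolynomial.C ((v k : ℚ) : ℂ)) → ∀ u : Fin (m + 1) → ℂ, MvPolynomial.eval u (MvPolynomial.aeval θ (Literature.NumberTheory.Transcendental.Nesterenko.chowForm 𝔭 (1 + 1))) = 0 ↔ ∃ β ∈ Literature.NumberTheory.Transcendental.Nesterenko.projZeros 𝔭, (∑ k, ((v k : ℚ) : ℂ) * β k =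 0) ∧ ∑ k, β k * u k = 0 := by
  intro m 𝔭 h𝔭 hhom hdim v θ hθ1 hθ0 u
  exact CurveHilbertSectionForm.eval_aeval_chowForm_eq_zero_iff h𝔭 hhom hdim v hθ1 hθ0 u

end Summit.Schanuel.Schanuel.Cruxes.ApproximationProperty.OrbitInterpolationDeterminant

end
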